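import Literature.AlgebraicGeometry.Resolution.BlowupsIntegral
import HarnessLib

/-!
# Strict transforms of closed sets compose along the piecewise blowing up of a disconnected centre

Topic: `Literature/AlgebraicGeometry/Resolution`. Theorem-only file (sorry-free, no definitions, no named facts).

In a Cossart–Jannsen–Saito sequence the new strict transform of the embedded scheme is the CLOSED SET
`X_{j+1} = cl(τ⁻¹(X_j ∖ V(C_j)))` and the new boundary is `τ⁻¹(B_j ∪ V(C_j))` (LNM 2270, (6.2); tree
`IsBPermissibleSequenceB`). When a disconnected centre `V(C) = Z₁ ⊔ T` is blown up PIECEWISE — first `τ₁` along (an ideal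
with support) `Z₁`, then `τ₂` along an ideal of `W₁` with support `τ₁⁻¹T` (Bierstone–Grigoriev–Milman–Włodarczyk 2011,
§4 Step 2b; Stacks 080A; tree `IsBlowup.exists_comp_eq_of_isPiecePartition_cons`) — the two-step strict transform of a
set `S` agrees with the one-step one:
`cl(τ₂⁻¹(cl(τ₁⁻¹(S ∖ Z₁)) ∖ τ₁⁻¹T)) = cl((τ₂ ≫ τ₁)⁻¹(S ∖ (Z₁ ∪ T)))`,
because a blowing up is an isomorphism — in particular an open embedding — over the complement of its centre (Stacks 02OS,
tree `IsBlowup.isOpenImmersion_preimage_compl_ι`), and closures commute with open embeddings.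

* `IsBlowup.preimage_closure_diff_support_subset` — `π⁻¹(cl A) ∖ π⁻¹V(J) ⊆ cl(π⁻¹A)` for any `A ⊆ X`;
* `IsBlowup.closure_preimage_closure_preimage_diff` — **the composition law** above;
* `preimage_union_comp` — the companion for the boundaries: `τ₂⁻¹(τ₁⁻¹(B ∪ Z₁) ∪ τ₁⁻¹T) = (τ₂ ≫ τ₁)⁻¹(B ∪ (Z₁ ∪ T))`.

Use (res-hironaka, chain W5.2, T5-E «W₂B-maxweight»): the induction over a CJS sequence whose centres are split into
connected components identifies the E-side data (strict transform of the host support, boundary) after the pieces loop with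
the next CJS state.

## References
* V. Cossart, U. Jannsen, S. Saito, LNM 2270 (2020), (6.2), Def. 6.8. [CossartJannsenSaito2020]
* E. Bierstone, D. Grigoriev, P. Milman, J. Włodarczyk, arXiv:1206.3090, §4 Step 2b. [BierstoneGrigorievMilmanWlodarczyk2011]
* The Stacks Project, Tags 02OS, 080A. [StacksProject]
-/

noncomputable section

open CategoryTheory CategoryTheory.Limits AlgebraicGeometry TopologicalSpace

namespace Literature.AlgebraicGeometry.Resolution

universe u

open Scheme.IdealSheafData

/-- **Closures pass across a blowing up off its centre**: for any `A ⊆ X`, every point of `π⁻¹(cl A)` not over the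
centre lies in `cl(π⁻¹A)` — over `X ∖ V(J)` the blowing up is an open embedding (Stacks 02OS), and preimages of closures
under open embeddings are closures of preimages. [cite: StacksProject, Tag 02OS] -/
theorem IsBlowup.preimage_closure_diff_support_subset {X X' : Scheme.{u}} {π : X' ⟶ X} {J : X.IdealSheafData}
    (hπ : IsBlowup π J) (A : Set X) :
    π ⁻¹' (closure A) \ π ⁻¹' (J.support : Set X) ⊆ closure (π ⁻¹' A) := by
  set V : X'.Opens := π ⁻¹ᵁ centreCompl J with hV
  set F : (V : Scheme.{u}) ⟶ X := V.ι ≫ π with hF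
  haveI : IsOpenImmersion F := hπ.isOpenImmersion_preimage_compl_ι
  rintro x' ⟨hxA, hxJ⟩
  have hxV : x' ∈ V := hxJ
  -- `x'` as a point of the open subscheme `V`
  set v : (V : Scheme.{u}) := ⟨x', hxV⟩ with hv
  have hvx : V.ι v = x' := rfl
  have hFv : ∀ w : (V : Scheme.{u}), F w = π (V.ι w) := fun w => by
    rw [hF, Scheme.Hom.comp_base, TopCat.coe_comp, Function.comp_apply]
  -- in `V`: `F⁻¹(cl A) = cl(F⁻¹ A)`
  have h1 : v ∈ F ⁻¹' closure A := by
    change F v ∈ closure A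
    rw [hFv, hvx]; exact hxA
  rw [F.isOpenEmbedding.isOpenMap.preimage_closure_eq_closure_preimage F.continuous] at h1
  -- push forward along the open embedding `V.ι`
  have h2 : V.ι v ∈ closure (V.ι '' (F ⁻¹' A)) :=
    (image_closure_subset_closure_image V.ι.continuous) ⟨v, h1, rfl⟩
  rw [hvx] at h2
  refine closure_mono ?_ h2
  rintro _ ⟨w, hw, rfl⟩
  change π (V.ι w) ∈ A
  rw [← hFv]; exact hw

/-- `cl(A) ∖ F ⊆ cl(A ∖ F)` for a closed set `F`. [folklore] -/
private theorem closure_diff_subset_closure_diff {α : Type*} [TopologicalSpace α] (A : Set α) {F : Set α} (hF : IsClosed F) :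
    closure A \ F ⊆ closure (A \ F) := by
  rw [Set.sdiff_eq, Set.sdiff_eq]
  exact hF.isOpen_compl.closure_inter

/-- **The composition law for strict transforms of closed sets along a piecewise blowing up.** Let `τ₁ : W₁ → W` be any
morphism (in the application: the blowing up of the first piece `Z₁`) and `τ₂ : W₂ → W₁` a blowing up along `J₂` with
`V(J₂) = τ₁⁻¹T` for a set `T ⊆ W` (the remaining pieces). Then for all `S, Z₁ ⊆ W`:
`cl(τ₂⁻¹(cl(τ₁⁻¹(S ∖ Z₁)) ∖ τ₁⁻¹T)) = cl((τ₂ ≫ τ₁)⁻¹(S ∖ (Z₁ ∪ T)))`.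
[cite: BierstoneGrigorievMilmanWlodarczyk2011, §4 Step 2b] [cite: CossartJannsenSaito2020, (6.2)] [cite: StacksProject, Tag 02OS] -/
theorem IsBlowup.closure_preimage_closure_preimage_diff {W W₁ W₂ : Scheme.{u}} (τ₁ : W₁ ⟶ W) {τ₂ : W₂ ⟶ W₁}
    {J₂ : W₁.IdealSheafData} (hτ₂ : IsBlowup τ₂ J₂) {T : Set W} (hT : (J₂.support : Set W₁) = τ₁ ⁻¹' T)
    (S Z₁ : Set W) :
    closure (τ₂ ⁻¹' (closure (τ₁ ⁻¹' (S \ Z₁)) \ τ₁ ⁻¹' T)) =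
      closure ((τ₂ ≫ τ₁) ⁻¹' (S \ (Z₁ ∪ T))) := by
  have hcomp : ((τ₂ ≫ τ₁) ⁻¹' (S \ (Z₁ ∪ T)) : Set W₂) = τ₂ ⁻¹' (τ₁ ⁻¹' (S \ Z₁) \ τ₁ ⁻¹' T) := by
    ext x
    simp only [Set.mem_preimage, Scheme.Hom.comp_base, TopCat.coe_comp, Function.comp_apply, Set.mem_sdiff, Set.mem_union,
      not_or]
    tauto
  rw [hcomp]
  apply le_antisymm
  · -- `⊆`: over `W₁ ∖ τ₁⁻¹T` the second blowing up is an open embedding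
    refine closure_minimal ?_ isClosed_closure
    intro x hx
    have hx' : τ₂ x ∈ closure (τ₁ ⁻¹' (S \ Z₁)) \ τ₁ ⁻¹' T := hx
    -- `cl(A) ∖ F ⊆ cl(A ∖ F)` with `F = τ₁⁻¹T` closed
    have hFc : IsClosed (τ₁ ⁻¹' T : Set W₁) := by rw [← hT]; exact J₂.support.isClosed
    have h1 : τ₂ x ∈ closure (τ₁ ⁻¹' (S \ Z₁) \ τ₁ ⁻¹' T) := closure_diff_subset_closure_diff _ hFc hx'
    exact hτ₂.preimage_closure_diff_support_subset _ ⟨h1, by rw [hT]; exact hx'.2⟩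
  · -- `⊇`: monotonicity
    exact closure_mono (Set.preimage_mono (Set.sdiff_subset_sdiff_left subset_closure))

/-- The companion for boundaries (preimages compose): `τ₂⁻¹(τ₁⁻¹(B ∪ Z₁) ∪ τ₁⁻¹T) = (τ₂ ≫ τ₁)⁻¹(B ∪ (Z₁ ∪ T))`.
[cite: CossartJannsenSaito2020, (6.2)] -/
theorem preimage_union_comp {W W₁ W₂ : Scheme.{u}} (τ₁ : W₁ ⟶ W) (τ₂ : W₂ ⟶ W₁) (B Z₁ T : Set W) :
    (τ₂ ⁻¹' (τ₁ ⁻¹' (B ∪ Z₁) ∪ τ₁ ⁻¹' T) : Set W₂) = (τ₂ ≫ τ₁) ⁻¹' (B ∪ (Z₁ ∪ T)) := by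
  ext x
  simp only [Set.mem_preimage, Set.mem_union, Scheme.Hom.comp_base, TopCat.coe_comp, Function.comp_apply]
  tauto

end Literature.AlgebraicGeometry.Resolution

end
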